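import Mathlib
import HarnessLib
import Literature.Geometry.DiscreteGeometry.KissingCertComp

/-!
# Bond-to-cap certificate: format and kernel-evaluable checker

Route `PricedLinkCensus`, item `SoftFourRings` (stmt-AtomisticToContinuum-14234), crux `Cap.BondToCap`
(seat c3).  Computational half of the checker of a pole-centred semidefinite certificate refuting an
empty cap of angular radius `57.175°` among twelve unit directions carrying `24` bonds: plain
`List`/`ℤ` programs on the sparse trivariate term lists `SPoly` of `Literature/…/PolyCert` (variables
`u = ⟪p,x⟫`, `v = ⟪p,y⟫`, `t = ⟪x,y⟫`), evaluated by the kernel (`decide`).  The MEANING of every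
construction and the soundness theorem are in `PricedLinkCensusSoftFourRingsCapCertDefs`; this file
imports only the reflective layer.

Contents: the polar kernels `capQPoly k` (recurrence `Q₀ = 1`, `Q₁ = t − uv`,
`Q_{k+2} = 2(t−uv)Q_{k+1} − (1−u²)(1−v²)Q_k`), weight polynomials `phiU/phiV`, the three-point part
`F3Poly` (blocks `(k, weight vectors)`), the Legendre couplings `LcoupOPoly`/`LcoupDPoly`/`c0Of`
(blocks `(l, vectors β :: γ)`), the off-diagonal functions `ObPoly`/`OnPoly`, the diagonal function
`DPoly`, the integer domain multipliers, the certificate record `CapCert` and the Boolean checks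
`checkD`, `checkB`, `checkN`, `checkFinal`.
-/

namespace Summit.AtomisticToContinuum.Crystallization.Theorems.Cap.Cert

open Literature.Geometry.DiscreteGeometry Literature.Geometry.DiscreteGeometry.PolyCert
  Literature.Geometry.DiscreteGeometry.PolyCert.SPoly

/-! ### Reflective kernels and weights -/

/-- `S = t − uv` as a term list. [folklore] -/
def Sp : SPoly := [(⟨0, 0, 1⟩, 1), (⟨1, 1, 0⟩, -1)]
/-- `E = (1 − u²)(1 − v²) = 1 − u² − v² + u²v²` as a term list. [folklore] -/
def Ep : SPoly := [(⟨0, 0, 0⟩, 1), (⟨2, 0, 0⟩, -1), (⟨0, 2, 0⟩, -1), (⟨2, 2, 0⟩, 1)]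

/-- The polar kernel `capQ k (t − uv) ((1−u²)(1−v²))` as a (sorted, normalised) term list, by the
two-step recurrence. [folklore] -/
def capQPoly : ℕ → SPoly
  | 0 => C 1
  | 1 => Sp
  | k + 2 => normalize (mulN (smul 2 Sp) (capQPoly (k + 1)) ++ neg (mulN Ep (capQPoly k)))

/-- `u^a`. [folklore] -/
def powU (a : ℕ) : SPoly := [(⟨a, 0, 0⟩, 1)]
/-- `v^a`. [folklore] -/
def powV (a : ℕ) : SPoly := [(⟨0, a, 0⟩, 1)]

/-- `φ_w(u) = Σ_a w_a u^a` as a term list. [folklore] -/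
def phiU (w : List ℤ) : SPoly := lsum ((List.range w.length).map fun a => smul (w.getD a 0) (powU a))
/-- `φ_w(v)`. [folklore] -/
def phiV (w : List ℤ) : SPoly := lsum ((List.range w.length).map fun a => smul (w.getD a 0) (powV a))

/-! ### The three-point part -/

/-- A three-point block: kernel degree `k` and integer weight vectors `w` (`A_k = Σ_w w wᵀ`). -/
structure TBlk where
  /-- degree of the polar kernel -/
  k : ℕ
  /-- weight vectors -/
  ws : List (List ℤ)

/-- `F₃ = Σ_(k,ws) Σ_w φ_w(u) φ_w(v) capQ_k` as a term list. [folklore] -/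
def F3Poly (bs : List TBlk) : SPoly :=
  lsum (bs.map fun b => lsum (b.ws.map fun w => mulN (mulN (phiU w) (phiV w)) (capQPoly b.k)))

/-! ### Legendre couplings with the pole -/

/-- A Legendre coupling block: degree `l` and integer vectors `β :: γ` (`B_l = Σ (β::γ)(β::γ)ᵀ`). -/
structure LBlk where
  /-- degree of the Legendre kernel -/
  l : ℕ
  /-- vectors `β :: γ₀ :: γ₁ :: …` -/
  vs : List (List ℤ)

/-- `L_l(t) = legendreI l t 1` as a term list. [folklore] -/
def legT (l : ℕ) : SPoly := legendreIPoly l T (C 1)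
/-- `L_l(u)`. [folklore] -/
def legU (l : ℕ) : SPoly := legendreIPoly l U (C 1)

/-- Pair part of the couplings: `Σ_(l,vs) Σ_(β::γ) γ(u) γ(v) L_l(t)`. [folklore] -/
def LcoupOPoly (bs : List LBlk) : SPoly :=
  lsum (bs.map fun b => lsum (b.vs.map fun v => mulN (mulN (phiU v.tail) (phiV v.tail)) (legT b.l)))

/-- Point (cross) part of the couplings: `Σ 2β γ(u) L_l(u)`. [folklore] -/
def LcoupDPoly (bs : List LBlk) : SPoly :=
  lsum (bs.map fun b => lsum (b.vs.map fun v => smul (2 * v.headD 0) (mulN (phiU v.tail) (legU b.l))))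

/-- Constant part of the couplings: `c₀ = Σ β² L_l(1)`. [folklore] -/
def c0Of (bs : List LBlk) : ℤ :=
  (bs.map fun b => (b.vs.map fun v => v.headD 0 ^ 2 * coeffSum (legT b.l)).sum).sum

/-! ### The certificate record, the functions `D`, `O_b`, `O_n`, and the checks -/

/-- The certificate (all integers; the certificate is a cone, so no denominators are needed):
three-point blocks, Legendre coupling blocks, the free polynomials `h_b, h_n` (coefficient lists in `u`,
index = power), the bounds `α, β_b, β_n`, the scale exponent `S` of the sum-of-squares identities
(written for `4^S · (bound − function)`), the Gram factors of the SOS multipliers and the residual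
slacks. [folklore] -/
structure CapCert where
  /-- three-point blocks -/
  tb : List TBlk
  /-- Legendre coupling blocks -/
  lb : List LBlk
  /-- free polynomial for bonded pairs -/
  hb : List ℤ
  /-- free polynomial for non-bonded pairs -/
  hn : List ℤ
  /-- bound of the point function -/
  alpha : ℤ
  /-- bound of the bonded-pair function -/
  betab : ℤ
  /-- bound of the non-bonded-pair function -/
  betan : ℤ
  /-- numerator of the cap level `cb = cbN / cbD` (all points have `⟪p, x⟫ ≤ cb`) -/
  cbN : ℤ
  /-- denominator of the cap level -/
  cbD : ℕ
  /-- scale exponent of the SOS identities -/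
  S : ℕ
  /-- Gram blocks of the point certificate: multipliers `1`, `(1+u)(cb−u)` -/
  gD : List GramBlk
  /-- Gram blocks of the bonded-pair certificate: multipliers `1, qU, qV, qTb, qUV, g` -/
  gb : List GramBlk
  /-- Gram blocks of the non-bonded-pair certificate: multipliers `1, qU, qV, qTn, qUV, g` -/
  gn : List GramBlk
  /-- residual slack of the point identity -/
  cD : ℕ
  /-- residual slack of the bonded identity -/
  cB : ℕ
  /-- residual slack of the non-bonded identity -/
  cN : ℕ

/-- Core pair function `F₃ + Legendre pair part`. [folklore] -/
def OcorePoly (c : CapCert) : SPoly := F3Poly c.tb ++ LcoupOPoly c.lb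
/-- Bonded-pair function `O_b = core + h_b(u) + h_b(v)`. [folklore] -/
def ObPoly (c : CapCert) : SPoly := OcorePoly c ++ phiU c.hb ++ phiV c.hb
/-- Non-bonded-pair function `O_n = core + h_n(u) + h_n(v)`. [folklore] -/
def OnPoly (c : CapCert) : SPoly := OcorePoly c ++ phiU c.hn ++ phiV c.hn
/-- Point function `D(u) = core(u,u,1) + 2βγ(u)L(u)-part − 8 h_b(u) − 14 h_n(u)`. [folklore] -/
def DPoly (c : CapCert) : SPoly :=
  substUU1 (OcorePoly c) ++ LcoupDPoly c.lb ++ smul (-8) (phiU c.hb) ++ smul (-14) (phiU c.hn)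

/-- `(1+u)(cbN − cbD·u) = cbD (1+u)(cb − u)`. [folklore] -/
def qU (c : CapCert) : SPoly := [(⟨0, 0, 0⟩, c.cbN), (⟨1, 0, 0⟩, c.cbN - c.cbD), (⟨2, 0, 0⟩, -(c.cbD : ℤ))]
/-- `cbD (1+v)(cb − v)`. [folklore] -/
def qV (c : CapCert) : SPoly := [(⟨0, 0, 0⟩, c.cbN), (⟨0, 1, 0⟩, c.cbN - c.cbD), (⟨0, 2, 0⟩, -(c.cbD : ℤ))]
/-- `(20000t − 9799)(5201 − 10201t) = 20000·10201 (t − tb)(ca − t)`, `tb = 1 − 1.01²/2`,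
`ca = 1 − 1/(2·1.01²)`. [folklore] -/
def qTb : SPoly := [(⟨0, 0, 0⟩, -50964599), (⟨0, 0, 1⟩, 203979599), (⟨0, 0, 2⟩, -204020000)]
/-- `(1+t)(101 − 200t) = 200 (1+t)(101/200 − t)`. [folklore] -/
def qTn : SPoly := [(⟨0, 0, 0⟩, 101), (⟨0, 0, 1⟩, -99), (⟨0, 0, 2⟩, -200)]
/-- `(cbN − cbD u)(cbN − cbD v) = cbD² (cb − u)(cb − v)`. [folklore] -/
def qUV (c : CapCert) : SPoly := mulN [(⟨0, 0, 0⟩, c.cbN), (⟨1, 0, 0⟩, -(c.cbD : ℤ))]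
  [(⟨0, 0, 0⟩, c.cbN), (⟨0, 1, 0⟩, -(c.cbD : ℤ))]

/-- Multipliers of the point certificate (in `u`). [folklore] -/
def multD (c : CapCert) : List SPoly := [C 1, qU c]
/-- Multipliers of the bonded-pair certificate. [folklore] -/
def multB (c : CapCert) : List SPoly := [C 1, qU c, qV c, qTb, qUV c, p4]
/-- Multipliers of the non-bonded-pair certificate. [folklore] -/
def multN (c : CapCert) : List SPoly := [C 1, qU c, qV c, qTn, qUV c, p4]

/-- `Σ_i m_i · zᵀ(L_i L_iᵀ)z` for multipliers `ms` and Gram blocks `gs` (zipped). [folklore] -/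
def sosPoly (ms : List SPoly) (gs : List GramBlk) : SPoly :=
  lsum (List.zipWith (fun m g => mulN m (quadL g)) ms gs)

/-- All Gram blocks have consistent lengths, and there are as many as multipliers. [folklore] -/
def gramsOK (ms : List SPoly) (gs : List GramBlk) : Bool :=
  decide (gs.length = ms.length) && gs.all GramBlk.lenOK

/-- The point check: `|4^S (α − D) − SOS_D − cD| ≤ cD` coefficientwise. [folklore] -/
def checkD (c : CapCert) : Bool :=
  gramsOK (multD c) c.gD &&
  residualBound (smul (4 ^ c.S) (C c.alpha ++ neg (DPoly c)) ++ neg (sosPoly (multD c) c.gD) ++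
    neg (C c.cD)) c.cD

/-- The bonded-pair check. [folklore] -/
def checkB (c : CapCert) : Bool :=
  gramsOK (multB c) c.gb &&
  residualBound (smul (4 ^ c.S) (C c.betab ++ neg (ObPoly c)) ++ neg (sosPoly (multB c) c.gb) ++
    neg (C c.cB)) c.cB

/-- The non-bonded-pair check. [folklore] -/
def checkN (c : CapCert) : Bool :=
  gramsOK (multN c) c.gn &&
  residualBound (smul (4 ^ c.S) (C c.betan ++ neg (OnPoly c)) ++ neg (sosPoly (multN c) c.gn) ++
    neg (C c.cN)) c.cN

/-- The final inequality `12 α + 48 β_b + 84 β_n + c₀ < 0` (the residual slacks are already inside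
the three identities). [folklore] -/
def checkFinal (c : CapCert) : Bool :=
  decide (12 * c.alpha + 48 * c.betab + 84 * c.betan + c0Of c.lb < 0)

/-- All checks. [folklore] -/
def checkAll (c : CapCert) : Bool :=
  decide (0 < c.cbD) && decide (c.cbN < c.cbD) && checkD c && checkB c && checkN c && checkFinal c

end Summit.AtomisticToContinuum.Crystallization.Theorems.Cap.Cert
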